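import Summits.BirchSwinnertonDyer.Rank1Residual.X11b.KolyvaginH44ConcreteData
import Summits.BirchSwinnertonDyer.Rank1Residual.X11b.KolyvaginTowerLiftConcrete
import HarnessLib

/-!
# Route `ErratumRoadFive`, crux `ShimuraKolyvaginOrderBoundInertFromFive` (item
# stmt-BirchSwinnertonDyer-19718) — CARRIER PORT K1: the ring-class TELESCOPE at every level, ANCHOR-FREE
# (no Heegner ∕ CM datum), with the coherent tower and the inter-level lift

Cell `bsd-stepL`, seat `bsd-stepL-shim-p1` (prover g8), HELPER for the crux
`Summit.BirchSwinnertonDyer.BirchSwinnertonDyer.Theses.ErratumRoadFive.ShimuraKolyvaginOrderBoundInertFromFive`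
(`--supports stmt-BirchSwinnertonDyer-19718 --as helper`; plan g29 RULING 2/3 (A): the Shimura Euler-system
CARRIER (α) is the live target of this seat; design memo HOME/shim/CARRIER-PORT-19718.md, file K1).

## Why

x11b3's concrete pipeline is keyed on the container `KolyvaginHeegnerData Dt β ι n`, which is EMPTY on the
Shimura locus (its fields `dvd_sq_sub : 4N ∣ β² − d_K` and `map_y` are the `X₀(N)` anchor). Its seam
`KolyvaginH44.exists_levelData` (`X11b/KolyvaginH44ConcreteData.lean`) produces, at every level `m`, the
abstract Euler data (`σ_m`, `H_m`, `f_m`, `π_m`, `j_m`, `e_m`) over `𝒢_m = ringClassGal ι m` from such a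
container. THIS FILE produces the same data WITHOUT any container — from the anchor-free coherent tower of
x11b3-p8 (`RingClassTower.exists_coherent_towerData_derivedPoint`: restriction homs `res_m`, generators
`g_q`, a transversal `T`, embeddings `emb_m`, coherent along `m ∣ n`, with the inter-level lift (β1) for ANY
point) — so that the Shimura CM points `y_m ∈ E(K[m])` can be fed in as bare data (files K2–K4).

## What is proved (theorems only; no `def`, no named fact, no `sorry`)

* §1 `map_pointGalHom_eq_smul_map` — `hj` for a bare embedding `e : K[m] → K̄`: if `τ ∈ Γ_K` restricts
  along `e` to `γ ∈ Aut(K[m])`, then `e_*(γ • P) = τ • e_* P` on `E(K[m])` (twin of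
  `KolyvaginHeegnerData.toGeomPoints_pointGalHom`).
* §2 `exists_section_of_transversal_image` — a section of `𝒢_m → 𝒢_m ⧸ G_m` valued in a given
  transversal (twin of `KolyvaginHeegnerData.exists_section_of_transversal`).
* §3 **`exists_ringClassLevelData`** — for `K` imaginary quadratic, `ι : K → ℂ`, a square-free top level
  `n` with inert prime factors and ANY Weierstrass curve `W/ℚ`: coherent tower data `(res, g, T, emb)` with
  the properties of `exists_coherent_towerData_derivedPoint` (generation ∕ `hord` ∕ transversal ∕ `emb` on
  `K` ∕ (β1) + embedding compatibility), AND at EVERY `m : ℕ` the END's data `σ_m, H_m, f_m, π_m, j_m, e_m`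
  with `hord`, `hj`, `hπρ`, `hfsec`, `hHρ`, tied at `m ∣ n` to the tower (`j_m = (emb_m)_*`,
  `σ_m q = res_m g_q`, `f_m` valued in `res_m(T)`, `e_m = emb_m`), junk (`j_m = 0`) off the divisors.

HONEST FRAMING: pure ring-class ∕ coordinate plumbing (no CM point, no Euler-system relation, no Selmer
statement); item 19718 and S1 ∕ S2 stay OPEN; BSD is not proved by any of this; no census number moves.
[cite: GrossLMS1991, §3 (p. 216–217: 𝒢_n, G_n, G_ℓ, σ_ℓ), §4 (4.1)] [cite: Cox2013, §9.A]
[cite: BertoliniDarmon1996, §2.3–2.5]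
presearch: n/a (plumbing over tree theorems); `lean search 'exists_ringClassLevelData|map_pointGalHom_eq_smul_map'` → none.
-/

noncomputable section

open scoped Classical

set_option linter.dupNamespace false

namespace Summit.BirchSwinnertonDyer.BirchSwinnertonDyer.Theorems

open WeierstrassCurve Field NumberField IsDedekindDomain Finset
  Literature.NumberTheory.EllipticCurves Literature.NumberTheory.GaloisRepresentations
  Literature.NumberTheory.EllipticCurves.RingClassField
  Summit.BirchSwinnertonDyer.Rank1Residual.X11b

-- `K : Type`: the tree's ring-class class field theory is universe `0`.
variable {K : Type} [Field K] [NumberField K]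

/-! ### §1 `hj` for a bare embedding -/

/-- **`e_*(γ • P) = τ • e_* P`**: for a ring homomorphism `e : K[m] → K̄`, `τ ∈ Γ_K` and `γ ∈ Aut(K[m])`
with `τ • e x = e (γ x)` for all `x`, the coordinatewise map `E(K[m]) → E(K̄)` along `e` intertwines `γ`
(`pointGalHom`) and `τ` — twin of x11b3's `KolyvaginHeegnerData.toGeomPoints_pointGalHom` for a bare `e`.
[folklore] -/
theorem map_pointGalHom_eq_smul_map (W : WeierstrassCurve ℚ) {ι : K →+* ℂ} {m : ℕ}
    (e : ringClassField K ι m →+* AlgebraicClosure K) {τ : absoluteGaloisGroup K}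
    {γ : ringClassField K ι m ≃ₐ[ℚ] ringClassField K ι m}
    (h : ∀ x : ringClassField K ι m, τ • e x = e (γ x))
    (j : (W.baseChange (ringClassField K ι m)).toAffine.Point →+ geomPoints (W.baseChange K))
    (hj : j = WeierstrassCurve.Affine.Point.map (W' := W) e.toRatAlgHom)
    (P : (W.baseChange (ringClassField K ι m)).toAffine.Point) :
    j (pointGalHom W (ringClassField K ι m) γ P) = τ • j P := by
  -- adapted from x11b3's `KolyvaginHeegnerData.toGeomPoints_pointGalHom` (there `j = d.toGeomPoints`)
  have hjQ : ∀ Q, j Q = WeierstrassCurve.Affine.Point.map (W' := W) e.toRatAlgHom Q := fun Q ↦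
    DFunLike.congr_fun hj Q
  rcases P with _ | ⟨x, y, hxy⟩
  · show j (pointGalHom W (ringClassField K ι m) γ 0) = τ • j 0
    rw [map_zero, map_zero, smul_zero]
  · have hγxy : (W.baseChange (ringClassField K ι m)).toAffine.Nonsingular (γ x) (γ y) :=
      (Affine.baseChange_nonsingular W (γ : ringClassField K ι m →ₐ[ℚ] ringClassField K ι m).injective
        x y).mpr hxy
    have hns : ((W.baseChange K).baseChange (AlgebraicClosure K)).toAffine.Nonsingular (e x) (e y) :=
      (Affine.baseChange_nonsingular W e.toRatAlgHom.injective x y).mpr hxy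
    have hns' : ((W.baseChange K).baseChange (AlgebraicClosure K)).toAffine.Nonsingular
        (e (γ x)) (e (γ y)) :=
      (Affine.baseChange_nonsingular W e.toRatAlgHom.injective (γ x) (γ y)).mpr hγxy
    have lhs : j (pointGalHom W (ringClassField K ι m) γ (.some x y hxy)) =
        Affine.Point.some (e (γ x)) (e (γ y)) hns' := by
      rw [pointGalHom_apply, Affine.Point.map_some, hjQ]
      show Affine.Point.map (W' := W) e.toRatAlgHom (.some (γ x) (γ y) _) = _
      rw [Affine.Point.map_some]
      rfl
    have rhs : τ • j (.some x y hxy) = Affine.Point.some (e (γ x)) (e (γ y)) hns' := by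
      rw [hjQ, Affine.Point.map_some]
      change Affine.Point.map (W' := W.baseChange K)
          ((absoluteGaloisGroup.toAlgEquiv K τ : AlgebraicClosure K ≃ₐ[K] AlgebraicClosure K) :
            AlgebraicClosure K →ₐ[K] AlgebraicClosure K)
          (Affine.Point.some (e x) (e y) hns) = _
      rw [Affine.Point.map_some]
      simp only [Affine.Point.some.injEq, AlgEquiv.coe_toAlgHom]
      exact ⟨h x, h y⟩
    rw [lhs, rhs]

/-! ### §2 A section over a given transversal -/

/-- **A section of `𝒢_m → 𝒢_m ⧸ G_m` with values in a transversal `S ⊆ 𝒢_m`** (`G_m = Gal(K[m]/K[1])`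
pulled back to `𝒢_m`; Gross 1991 (4.1)) — twin of x11b3's
`KolyvaginHeegnerData.exists_section_of_transversal` for a bare transversal. [cite: GrossLMS1991, §4 (4.1)] -/
theorem exists_section_of_transversal_image (ι : K →+* ℂ) (m : ℕ)
    (S : Finset (ringClassField K ι m ≃ₐ[ℚ] ringClassField K ι m))
    (hSsub : ∀ s ∈ S, s ∈ ringClassGal ι m)
    (hStr : ∀ h ∈ ringClassGal ι m, ∃! s, s ∈ S ∧ h⁻¹ * s ∈ ringClassGalOver ι m 1) :
    ∃ f : ringClassGal ι m ⧸ (ringClassGalOver ι m 1).comap (ringClassGal ι m).subtype →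
        ringClassGal ι m,
      (∀ c, (f c : ringClassGal ι m ⧸ (ringClassGalOver ι m 1).comap (ringClassGal ι m).subtype) = c) ∧
      ∀ c, (f c : ringClassField K ι m ≃ₐ[ℚ] ringClassField K ι m) ∈ S := by
  -- adapted from x11b3's `KolyvaginHeegnerData.exists_section_of_transversal`
  set H := (ringClassGalOver ι m 1).comap (ringClassGal ι m).subtype with hH
  have hex : ∀ c : ringClassGal ι m ⧸ H, ∃ s : ringClassGal ι m,
      (s : ringClassGal ι m ⧸ H) = c ∧ (s : ringClassField K ι m ≃ₐ[ℚ] ringClassField K ι m) ∈ S := by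
    intro c
    obtain ⟨g, rfl⟩ := QuotientGroup.mk_surjective c
    obtain ⟨s, ⟨hsS, hgs⟩, -⟩ := hStr g g.2
    refine ⟨⟨s, hSsub s hsS⟩, ?_, hsS⟩
    rw [eq_comm, QuotientGroup.eq, hH, Subgroup.mem_comap]
    simpa using hgs
  choose f hf hfS using hex
  exact ⟨f, hf, hfS⟩

/-! ### §3 The anchor-free level data, coherent along the tower -/

/-- **The ring-class telescope at every level, anchor-free, with the coherent tower and the inter-level
lift.** For `K` imaginary quadratic, `ι : K → ℂ`, a square-free `n` whose prime factors are inert in `K`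
(automatic at Kolyvagin levels) and any `W/ℚ`: there are coherent tower data — restriction homs
`res_m : 𝒢_n → Aut_ℚ(K[m])` with the value formula, elements `g_q ∈ 𝒢_n` whose restrictions generate
`Gal(K[m]/K[m/q])` with `(res_m g_q)^{q+1} = 1`, a transversal `T` restricting to transversals of
`Gal(K[m]/K[1])`, `K`-embeddings `emb_m : K[m] → K̄`, the INTER-LEVEL LIFT (β1) (the level-`m` derived point
of `z↑` is the base change of the level-`m'` derived point of `z`, for ANY `z ∈ E(K[m'])`, `m' ∣ m ∣ n`) and
the compatibility of the `emb_m` with base change (all from x11b3-p8's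
`RingClassTower.exists_coherent_towerData_derivedPoint`) — AND, at EVERY `m : ℕ`, the END's level data
`σ_m, H_m, f_m, π_m, j_m, e_m` over `𝒢_m = ringClassGal ι m` (`hord`, `hj`, `hπρ`, `hfsec`, `hHρ`) tied to
the tower at `m ∣ n` (`j_m = (emb_m)_*`, `σ_m q = res_m g_q` on the prime factors, `f_m` valued in `res_m(T)`,
`e_m = emb_m`), junk off the divisors (`j_m = 0`). This is x11b3's `KolyvaginH44.exists_levelData` with the
`X₀(N)` container removed: the CM points are NOT among the data (they enter in K2–K4 as bare points
`y_m ∈ E(K[m])`). [cite: GrossLMS1991, §3 (p. 216–217), §4 (4.1)] [cite: Cox2013, §9.A] -/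
theorem exists_ringClassLevelData (hK : IsImaginaryQuadratic K) (ι : K →+* ℂ) {n : ℕ} (hn : Squarefree n)
    (hinert : ∀ q ∈ n.primeFactors, (Ideal.span {(q : 𝓞 K)}).IsPrime) (W : WeierstrassCurve ℚ) :
    ∃ (res : (m : ℕ) → (ringClassGal ι n →* (ringClassField K ι m ≃ₐ[ℚ] ringClassField K ι m)))
      (g : ℕ → ringClassGal ι n) (T : Finset (ringClassGal ι n))
      (emb : (m : ℕ) → m ∣ n → (ringClassField K ι m →+* AlgebraicClosure K))
      (σ : (m : ℕ) → ℕ → ringClassGal ι m)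
      (H : (m : ℕ) → Subgroup (ringClassGal ι m))
      (f : (m : ℕ) → ringClassGal ι m ⧸ H m → ringClassGal ι m)
      (π : (m : ℕ) → (absoluteGaloisGroup K →* ringClassGal ι m))
      (j : (m : ℕ) → ((W.baseChange (ringClassField K ι m)).toAffine.Point →+ geomPoints (W.baseChange K)))
      (e : (m : ℕ) → (ringClassField K ι m →ₐ[K] AlgebraicClosure K)),
      -- the coherent tower (x11b3-p8)
      (∀ m, m ∣ n → ∀ (t : ringClassGal ι n) (x : ringClassField K ι m) (z : ringClassField K ι n),
        (x : ℂ) = (z : ℂ) → ((res m t x : ringClassField K ι m) : ℂ) =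
          (((t : ringClassField K ι n ≃ₐ[ℚ] ringClassField K ι n) z : ringClassField K ι n) : ℂ)) ∧
      (∀ m, m ∣ n → ∀ q ∈ m.primeFactors,
        Subgroup.zpowers (res m (g q)) = ringClassGalOver ι m (m / q) ∧ res m (g q) ^ (q + 1) = 1) ∧
      (∀ m, m ∣ n → ∀ h ∈ ringClassGal ι m,
        ∃! s, s ∈ T.image (fun t => res m t) ∧ h⁻¹ * s ∈ ringClassGalOver ι m 1) ∧
      (∀ (m : ℕ) (hm : m ∣ n) (k : K),
        emb m hm (algebraMap K (ringClassField K ι m) k) = algebraMap K (AlgebraicClosure K) k) ∧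
      (∀ (m : ℕ) (hm : m ∣ n) (m' : ℕ) (hm'm : m' ∣ m)
        (hle : ringClassField K ι m' ≤ ringClassField K ι m) (k : ℕ)
        (z : (W.baseChange (ringClassField K ι m')).toAffine.Point),
        letI : Algebra K ℂ := ι.toAlgebra
        KolyvaginOperator.derivedPoint (pointGalHom W (ringClassField K ι m)) (fun q => res m (g q)) k
            (T.image (fun t => res m t))
            (WeierstrassCurve.Affine.Point.map (W' := W)
              ((RingClassField.inclusion ι hle).restrictScalars ℚ) z) =
          WeierstrassCurve.Affine.Point.map (W' := W)
              ((RingClassField.inclusion ι hle).restrictScalars ℚ)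
            (KolyvaginOperator.derivedPoint (pointGalHom W (ringClassField K ι m'))
              (fun q => res m' (g q)) k (T.image (fun t => res m' t)) z) ∧
        WeierstrassCurve.Affine.Point.map (W' := W) (emb m hm).toRatAlgHom
            (WeierstrassCurve.Affine.Point.map (W' := W)
              ((RingClassField.inclusion ι hle).restrictScalars ℚ)
              (KolyvaginOperator.derivedPoint (pointGalHom W (ringClassField K ι m'))
                (fun q => res m' (g q)) k (T.image (fun t => res m' t)) z)) =
          WeierstrassCurve.Affine.Point.map (W' := W) (emb m' (hm'm.trans hm)).toRatAlgHom
            (KolyvaginOperator.derivedPoint (pointGalHom W (ringClassField K ι m'))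
              (fun q => res m' (g q)) k (T.image (fun t => res m' t)) z)) ∧
      -- the level data, at every level
      (∀ m, ∀ q ∈ m.primeFactors, σ m q ^ (q + 1) = 1) ∧
      (∀ m (τ : absoluteGaloisGroup K) (P : (W.baseChange (ringClassField K ι m)).toAffine.Point),
        j m (pointGalHom W (ringClassField K ι m)
          (π m τ : ringClassField K ι m ≃ₐ[ℚ] ringClassField K ι m) P) = τ • j m P) ∧
      (∀ m (τ : absoluteGaloisGroup K) (x : ringClassField K ι m),
        τ • e m x = e m ((π m τ : ringClassField K ι m ≃ₐ[ℚ] ringClassField K ι m) x)) ∧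
      (∀ m c, (f m c : ringClassGal ι m ⧸ H m) = c) ∧
      (∀ m, ∀ h ∈ H m, (h : ringClassField K ι m ≃ₐ[ℚ] ringClassField K ι m) ∈ ringClassGalOver ι m 1) ∧
      -- the dictionary at the divisors, junk off them
      (∀ (m : ℕ) (hm : m ∣ n),
        j m = (WeierstrassCurve.Affine.Point.map (W' := W) (emb m hm).toRatAlgHom :
          (W.baseChange (ringClassField K ι m)).toAffine.Point →+ geomPoints (W.baseChange K)) ∧
        (∀ q ∈ m.primeFactors,
          (σ m q : ringClassField K ι m ≃ₐ[ℚ] ringClassField K ι m) = res m (g q)) ∧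
        (∀ c, (f m c : ringClassField K ι m ≃ₐ[ℚ] ringClassField K ι m) ∈ T.image (fun t => res m t)) ∧
        (∀ x, e m x = emb m hm x)) ∧
      (∀ m, ¬ m ∣ n → j m = 0) := by
  have hn0 : n ≠ 0 := Squarefree.ne_zero hn
  obtain ⟨res, g, T, emb, h1, h4, h5, he1, hβ⟩ :=
    RingClassTower.exists_coherent_towerData_derivedPoint (W := W) hK ι hn hinert
  -- `res m t ∈ 𝒢_m` (the restriction fixes `ι(K)`)
  have hresG : ∀ m, m ∣ n → ∀ t : ringClassGal ι n, res m t ∈ ringClassGal ι m := fun m hm t ↦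
    RingClassTower.restrictHom_mem_ringClassGal ι (h1 m hm) t
  -- per-level data
  have hlev : ∀ m : ℕ, ∃ (σ : ℕ → ringClassGal ι m) (H : Subgroup (ringClassGal ι m))
      (f : ringClassGal ι m ⧸ H → ringClassGal ι m) (π : absoluteGaloisGroup K →* ringClassGal ι m)
      (j : (W.baseChange (ringClassField K ι m)).toAffine.Point →+ geomPoints (W.baseChange K))
      (e : ringClassField K ι m →ₐ[K] AlgebraicClosure K),
      (∀ q ∈ m.primeFactors, σ q ^ (q + 1) = 1) ∧
      (∀ (τ : absoluteGaloisGroup K) (P : (W.baseChange (ringClassField K ι m)).toAffine.Point),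
        j (pointGalHom W (ringClassField K ι m)
          (π τ : ringClassField K ι m ≃ₐ[ℚ] ringClassField K ι m) P) = τ • j P) ∧
      (∀ (τ : absoluteGaloisGroup K) (x : ringClassField K ι m),
        τ • e x = e ((π τ : ringClassField K ι m ≃ₐ[ℚ] ringClassField K ι m) x)) ∧
      (∀ c, (f c : ringClassGal ι m ⧸ H) = c) ∧
      (∀ h ∈ H, (h : ringClassField K ι m ≃ₐ[ℚ] ringClassField K ι m) ∈ ringClassGalOver ι m 1) ∧
      (∀ hm : m ∣ n,
        j = (WeierstrassCurve.Affine.Point.map (W' := W) (emb m hm).toRatAlgHom :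
          (W.baseChange (ringClassField K ι m)).toAffine.Point →+ geomPoints (W.baseChange K)) ∧
        (∀ q ∈ m.primeFactors,
          (σ q : ringClassField K ι m ≃ₐ[ℚ] ringClassField K ι m) = res m (g q)) ∧
        (∀ c, (f c : ringClassField K ι m ≃ₐ[ℚ] ringClassField K ι m) ∈ T.image (fun t => res m t)) ∧
        (∀ x, e x = emb m hm x)) ∧
      (¬ m ∣ n → j = 0) := by
    intro m
    by_cases hm : m ∣ n
    · -- a genuine level
      let e : ringClassField K ι m →ₐ[K] AlgebraicClosure K :=
        { (emb m hm) with commutes' := he1 m hm }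
      have he : ∀ x, e x = emb m hm x := fun _ ↦ rfl
      obtain ⟨π, hπ⟩ := KolyvaginH44.exists_absGaloisRestrict hK ι m e
      obtain ⟨f, hf, hfS⟩ := exists_section_of_transversal_image ι m (T.image (fun t => res m t))
        (fun s hs ↦ by
          obtain ⟨t, -, rfl⟩ := Finset.mem_image.mp hs
          exact hresG m hm t)
        (h5 m hm)
      let σ : ℕ → ringClassGal ι m := fun q ↦
        if hq : q ∈ m.primeFactors then ⟨res m (g q), hresG m hm (g q)⟩ else 1
      have hσ : ∀ q ∈ m.primeFactors,
          (σ q : ringClassField K ι m ≃ₐ[ℚ] ringClassField K ι m) = res m (g q) := fun q hq ↦ by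
        simp only [σ, dif_pos hq]
      refine ⟨σ, _, f, π,
        (WeierstrassCurve.Affine.Point.map (W' := W) (emb m hm).toRatAlgHom :
          (W.baseChange (ringClassField K ι m)).toAffine.Point →+ geomPoints (W.baseChange K)),
        e, ?_, ?_, hπ, hf, ?_, fun hm' ↦ ⟨rfl, hσ, hfS, he⟩, fun h ↦ (h hm).elim⟩
      · intro q hq
        apply Subtype.ext
        rw [SubmonoidClass.coe_pow, hσ q hq, OneMemClass.coe_one]
        exact (h4 m hm q hq).2
      · intro τ P
        exact map_pointGalHom_eq_smul_map W (emb m hm) (fun x ↦ by rw [← he, ← he]; exact hπ τ x) _ rfl P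
      · intro h hh
        exact Subgroup.mem_comap.mp hh
    · -- a junk level
      obtain ⟨e⟩ := KolyvaginH44.nonempty_algHom_ringClassField hK ι m
      obtain ⟨π, hπ⟩ := KolyvaginH44.exists_absGaloisRestrict hK ι m e
      refine ⟨fun _ ↦ 1, (ringClassGalOver ι m 1).comap (ringClassGal ι m).subtype,
        fun c ↦ c.out, π, 0, e, fun _ _ ↦ one_pow _, fun τ P ↦ ?_, hπ,
        fun c ↦ QuotientGroup.out_eq' c, fun h hh ↦ Subgroup.mem_comap.mp hh,
        fun hm' ↦ (hm hm').elim, fun _ ↦ rfl⟩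
      rw [AddMonoidHom.zero_apply, AddMonoidHom.zero_apply, smul_zero]
  choose σ H f π j e hord hj hπρ hfsec hHρ hdict hjunk using hlev
  exact ⟨res, g, T, emb, σ, H, f, π, j, e, h1, h4, h5, he1, hβ, hord, hj, hπρ, hfsec, hHρ, hdict, hjunk⟩

end Summit.BirchSwinnertonDyer.BirchSwinnertonDyer.Theorems

end
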